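import Summits.Parity.GeneralizedHardyLittlewood.Theorems.ModelHyperbolicity.Negative.ModelHyperbolicityLoadBearing

/-!
# `ModelHyperbolicity` (stmt-Parity-14110): `x₀` cannot be uniform in `u` — `x₀(u) > 2^{u-1}`

Negative lemmas for the crux `LeeYangFibres.ModelHyperbolicity` (cdisprove seat), part 2
(QUANTIFIER ORDER). The crux is `∀ u ≥ 2, ∃ x₀, ∀ x ≥ x₀, RealRootedAt u x`; the uniform form
`∃ x₀, ∀ u ≥ 2, ∀ x ≥ x₀, RealRootedAt u x` (`ModelHyperbolicityUniform`, which implies the crux,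
`modelHyperbolicity_of_uniform`) is FALSE (`not_modelHyperbolicityUniform`); quantitatively
`¬ RealRootedAt u (2^{u-1})` for every `u ≥ 6` (`not_realRootedAt_two_pow_pred`), i.e. the crux's
threshold satisfies `x₀(u) > 2^{u-1}`. Mechanism: at `x = 2^k`, `u = k+1` every `n ≥ 2` is rough,
the three top Landau cells are `1, 2, 7` for all `k ≥ 5` (`card_lset_top`: doubling bijection
`lset_succ_eq_image` behind the wall `2^{k+1} < 3^{k-1}`, base `x = 32`), and a monic polynomial
with `e₁ = -2`, `e₂ = 7` has `Σ r² = e₁² − 2e₂ = −10 < 0` (Vieta `coeff_eq_esymm_roots_of_card`,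
Newton `sum_map_sq_eq`), so one zero is non-real. (Numerically the same top-cell obstruction holds
at `x = B^u − 1` for every prime `B ≤ 13` once `u ≥ u₀(B)`: the stabilised top cells
`(2,7,15)`, `(4,17,78)`, `(15,182,1763)`, `(32,722,12329)`, `(402,29202,1247122)`,
`(461,47696,2820952)` all have `e₁² < 2e₂`; so conjecturally `x₀(u)^{1/u} → ∞`.) [folklore]
-/

namespace Summit.Parity.GeneralizedHardyLittlewood.Theorems.ModelHyperbolicity.Negative

open Summit.Parity.GeneralizedHardyLittlewood.Theses.LeeYangFibres
open Finset Polynomial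
open scoped Classical

/-! ## Quantifier order: `x₀` cannot be uniform in `u`

Witness family `x = 2^k`, `u = k + 1` (`k ≥ 5`): the threshold `2^{k/(k+1)} < 2` makes every `n ≥ 2`
rough, the top three cells are `A_k = 1` (`2^k`), `A_{k-1} = 2` (`2^{k-1}, 3·2^{k-2}`),
`A_{k-2} = 7` (`2^{k-5}·{8,12,18,20,27,28,30}`), stable under `k ↦ k+1` by the doubling bijection
`n ↦ 2n` (an odd `n` with `Ω(n) ≥ k-1` has `n ≥ 3^{k-1} > 2^{k+1}`).  For a monic real-rooted
polynomial `Σ r_i² = e₁² − 2e₂ = 2² − 2·7 = −10 < 0` is impossible. Hence `x₀(u) > 2^{u-1}` for all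
`u ≥ 6`, and no `x₀` serves all `u`. -/

/-- `4·2^m < 3^m` for `m ≥ 4`. -/
theorem four_mul_two_pow_lt_three_pow (m : ℕ) (hm : 4 ≤ m) : 4 * 2 ^ m < 3 ^ m := by
  induction m, hm using Nat.le_induction with
  | base => norm_num
  | succ m hm ih =>
    calc 4 * 2 ^ (m + 1) = 2 * (4 * 2 ^ m) := by ring
      _ < 2 * 3 ^ m := by omega
      _ ≤ 3 ^ (m + 1) := by rw [pow_succ]; omega

/-- `2^{k+1} < 3^{k-1}` for `k ≥ 5` (the `3`-adic wall used by the doubling bijection). -/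
theorem two_pow_succ_lt_three_pow_pred {k : ℕ} (hk : 5 ≤ k) : 2 ^ (k + 1) < 3 ^ (k - 1) := by
  obtain ⟨m, rfl⟩ : ∃ m, k = m + 1 := ⟨k - 1, by omega⟩
  have := four_mul_two_pow_lt_three_pow m (by omega)
  rw [Nat.add_sub_cancel, show 2 ^ (m + 1 + 1) = 4 * 2 ^ m by ring]
  exact this

/-- The doubling bijection: below the `3`-adic wall, `{n ≤ 2^{k+1} : Ω(n) = j+1} = 2·{m ≤ 2^k : Ω(m) = j}`. -/
theorem lset_succ_eq_image {k j : ℕ} (h3 : 2 ^ (k + 1) < 3 ^ (j + 1)) (hj : 1 ≤ j) :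
    lset (2 ^ (k + 1)) (j + 1) = (lset (2 ^ k) j).image (fun m => 2 * m) := by
  ext n
  simp only [lset, Finset.mem_filter, Finset.mem_Icc, Finset.mem_image]
  constructor
  · rintro ⟨⟨hn1, hnle⟩, hn2, hΩ⟩
    have heven : Even n := by
      by_contra hodd
      rw [Nat.not_even_iff_odd] at hodd
      have h3n := three_pow_cardFactors_le_of_odd hodd
      rw [hΩ] at h3n
      omega
    obtain ⟨m, rfl⟩ := heven
    have hm0 : m ≠ 0 := by omega
    have hΩm : ArithmeticFunction.cardFactors m = j := by
      have h2m : ArithmeticFunction.cardFactors (2 * m) = 1 + ArithmeticFunction.cardFactors m := by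
        rw [ArithmeticFunction.cardFactors_mul two_ne_zero hm0,
          ArithmeticFunction.cardFactors_apply_prime Nat.prime_two]
      rw [two_mul] at h2m
      omega
    refine ⟨m, ⟨⟨by omega, ?_⟩, ?_, hΩm⟩, by omega⟩
    · rw [pow_succ] at hnle
      omega
    · by_contra hm2
      have hm1 : m = 1 := by omega
      subst hm1
      simp at hΩm
      omega
  · rintro ⟨m, ⟨⟨hm1, hmle⟩, hm2, hΩm⟩, rfl⟩
    refine ⟨⟨by omega, ?_⟩, by omega, ?_⟩
    · rw [pow_succ]
      omega
    · rw [ArithmeticFunction.cardFactors_mul two_ne_zero (by omega),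
        ArithmeticFunction.cardFactors_apply_prime Nat.prime_two, hΩm]
      ring

/-- Cardinality form of the doubling bijection. -/
theorem card_lset_succ {k j : ℕ} (h3 : 2 ^ (k + 1) < 3 ^ (j + 1)) (hj : 1 ≤ j) :
    (lset (2 ^ (k + 1)) (j + 1)).card = (lset (2 ^ k) j).card := by
  rw [lset_succ_eq_image h3 hj, Finset.card_image_of_injective _ (mul_right_injective₀ two_ne_zero)]

/-- Base case `x = 32`: `#{n ≤ 32 : Ω = 5} = 1`, `#{Ω = 4} = 2`, `#{Ω = 3} = 7`. -/
theorem card_lset_32 :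
    (lset 32 5).card = 1 ∧ (lset 32 4).card = 2 ∧ (lset 32 3).card = 7 := by
  refine ⟨?_, ?_, ?_⟩ <;>
  · unfold lset
    rw [Finset.card_filter]
    simp [Finset.sum_Icc_succ_top, ArithmeticFunction.cardFactors_apply, Nat.primeFactorsList_ofNat]

/-- The three top Landau cells at `x = 2^k` are `1, 2, 7` for every `k ≥ 5`. -/
theorem card_lset_top (k : ℕ) (hk : 5 ≤ k) :
    (lset (2 ^ k) k).card = 1 ∧ (lset (2 ^ k) (k - 1)).card = 2 ∧ (lset (2 ^ k) (k - 2)).card = 7 := by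
  induction k, hk using Nat.le_induction with
  | base => exact card_lset_32
  | succ k hk ih =>
    obtain ⟨h0, h1, h2⟩ := ih
    refine ⟨?_, ?_, ?_⟩
    · rw [card_lset_succ (Nat.pow_lt_pow_left (by norm_num) (by omega)) (by omega), h0]
    · rw [show k + 1 - 1 = (k - 1) + 1 by omega, card_lset_succ ?_ (by omega), h1]
      rw [show k - 1 + 1 = k by omega]
      exact lt_of_lt_of_le (two_pow_succ_lt_three_pow_pred hk) (Nat.pow_le_pow_right (by norm_num) (by omega))
    · rw [show k + 1 - 2 = (k - 2) + 1 by omega, card_lset_succ ?_ (by omega), h2]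
      rw [show k - 2 + 1 = k - 1 by omega]
      exact two_pow_succ_lt_three_pow_pred hk

/-- The Landau cell polynomial at `x = 2^k` as an honest polynomial over `ℂ`. -/
noncomputable def LP (k : ℕ) : ℂ[X] :=
  ∑ j ∈ Finset.range (k + 2), C (((lset (2 ^ k) j).card : ℕ) : ℂ) * X ^ j

/-- Coefficients of `LP k`. -/
theorem LP_coeff (k i : ℕ) :
    (LP k).coeff i = if i < k + 2 then (((lset (2 ^ k) i).card : ℕ) : ℂ) else 0 := by
  unfold LP
  rw [finsetSum_coeff]
  simp only [coeff_C_mul_X_pow]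
  rw [Finset.sum_ite_eq]
  simp [Finset.mem_range]

/-- Evaluation of `LP k`. -/
theorem LP_eval (k : ℕ) (z : ℂ) :
    (LP k).eval z = ∑ j ∈ Finset.range (k + 2), (((lset (2 ^ k) j).card : ℕ) : ℂ) * z ^ j := by
  unfold LP
  rw [eval_finsetSum]
  simp only [eval_mul, eval_C, eval_pow, eval_X]

/-- `P_{k+1,2^k}` is the evaluation of `LP k`. -/
theorem cellPoly_eq_LP_eval (k : ℕ) (z : ℂ) : cellPoly (k + 1) (2 ^ k) z = (LP k).eval z := by
  unfold cellPoly
  rw [LP_eval]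
  refine Finset.sum_congr rfl fun j _ => ?_
  rw [cell_eq_card_lset Nat.one_le_two_pow (Nat.pow_lt_pow_right (by norm_num) (by omega)) (by omega)]

/-- `LP k` has degree `k` (`k ≥ 5`). -/
theorem LP_natDegree (k : ℕ) (hk : 5 ≤ k) : (LP k).natDegree = k := by
  apply natDegree_eq_of_le_of_coeff_ne_zero
  · rw [natDegree_le_iff_coeff_eq_zero]
    intro N hN
    rw [LP_coeff]
    split_ifs with hlt
    · have hN' : N = k + 1 := by omega
      subst hN'
      rw [lset_eq_empty_of_lt (Nat.pow_lt_pow_right (by norm_num) (by omega))]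
      simp
    · rfl
  · rw [LP_coeff, if_pos (by omega), (card_lset_top k hk).1]
    simp

/-- `LP k` is monic (`k ≥ 5`). -/
theorem LP_leadingCoeff (k : ℕ) (hk : 5 ≤ k) : (LP k).leadingCoeff = 1 := by
  rw [leadingCoeff, LP_natDegree k hk, LP_coeff, if_pos (by omega), (card_lset_top k hk).1]
  simp

/-- Newton's identity `p₂ = e₁² − 2e₂` for a multiset. -/
theorem esymm_one_eq_sum {R : Type*} [CommRing R] (s : Multiset R) : s.esymm 1 = s.sum := by
  simp [Multiset.esymm, Multiset.powersetCard_one, Multiset.map_map]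

/-- `e₂(a :: s) = e₂(s) + a·Σ s`. -/
theorem esymm_two_cons {R : Type*} [CommRing R] (a : R) (s : Multiset R) :
    (a ::ₘ s).esymm 2 = s.esymm 2 + a * s.sum := by
  simp only [Multiset.esymm]
  rw [show (2 : ℕ) = 1 + 1 from rfl, Multiset.powersetCard_cons, Multiset.map_add, Multiset.sum_add,
    Multiset.map_map, Multiset.powersetCard_one, Multiset.map_map]
  congr 1
  simp only [Function.comp_def, Multiset.prod_cons, Multiset.prod_singleton]
  rw [Multiset.sum_map_mul_left, Multiset.map_id']

/-- Newton: `Σ r² = (Σ r)² − 2 e₂`. -/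
theorem sum_map_sq_eq {R : Type*} [CommRing R] (s : Multiset R) :
    (s.map (fun r => r ^ 2)).sum = s.sum ^ 2 - 2 * s.esymm 2 := by
  induction s using Multiset.induction_on with
  | empty => simp [Multiset.esymm]
  | cons a s ih =>
    rw [Multiset.map_cons, Multiset.sum_cons, Multiset.sum_cons, esymm_two_cons, ih]
    ring

/-- `re` of a multiset sum. -/
theorem re_multiset_sum (s : Multiset ℂ) : s.sum.re = (s.map Complex.re).sum := by
  induction s using Multiset.induction_on with
  | empty => simp
  | cons a s ih => simp [ih]

/-- E1: `P_{k+1, 2^k}` has a non-real zero for every `k ≥ 5` (so `x₀(u) > 2^{u-1}` for `u ≥ 6`). -/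
theorem not_realRootedAt_succ_two_pow (k : ℕ) (hk : 5 ≤ k) : ¬ RealRootedAt (k + 1) (2 ^ k) := by
  intro hreal
  obtain ⟨-, h1, h2⟩ := card_lset_top k hk
  have hdeg := LP_natDegree k hk
  have hlead := LP_leadingCoeff k hk
  have hroots : (LP k).roots.card = (LP k).natDegree := IsAlgClosed.card_roots_eq_natDegree
  have hv1 := coeff_eq_esymm_roots_of_card hroots (show k - 1 ≤ (LP k).natDegree by omega)
  have hv2 := coeff_eq_esymm_roots_of_card hroots (show k - 2 ≤ (LP k).natDegree by omega)
  rw [hdeg, hlead, LP_coeff, if_pos (by omega), h1, show k - (k - 1) = 1 by omega] at hv1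
  rw [hdeg, hlead, LP_coeff, if_pos (by omega), h2, show k - (k - 2) = 2 by omega] at hv2
  have he1 : (LP k).roots.sum = -2 := by
    rw [← esymm_one_eq_sum]
    push_cast at hv1
    linear_combination hv1
  have he2 : (LP k).roots.esymm 2 = 7 := by
    push_cast at hv2
    linear_combination -hv2
  -- every root is real
  have hP0 : LP k ≠ 0 := fun h => by rw [h, natDegree_zero] at hdeg; omega
  have him : ∀ r ∈ (LP k).roots, r.im = 0 := fun r hr =>
    hreal r (by rw [cellPoly_eq_LP_eval]; exact (mem_roots hP0).mp hr)
  -- Newton: Σ r² = e₁² - 2 e₂ = 4 - 14 = -10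
  have hN := sum_map_sq_eq (LP k).roots
  rw [he1, he2] at hN
  -- but Σ r² = Σ (re r)² ≥ 0
  have hre : ((LP k).roots.map (fun r => r ^ 2)).sum.re = ((LP k).roots.map (fun r => r.re ^ 2)).sum := by
    rw [re_multiset_sum, Multiset.map_map]
    congr 1
    refine Multiset.map_congr rfl fun r hr => ?_
    simp only [Function.comp_apply, sq, Complex.mul_re, him r hr]
    ring
  have hnonneg : 0 ≤ ((LP k).roots.map (fun r => r.re ^ 2)).sum :=
    Multiset.sum_nonneg fun x hx => by
      obtain ⟨r, -, rfl⟩ := Multiset.mem_map.mp hx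
      positivity
  rw [hN] at hre
  norm_num at hre
  linarith

/-- "`x₀` uniform in `u`": the crux with `∃ x₀` pulled in front of `∀ u`. -/
def ModelHyperbolicityUniform : Prop :=
  ∃ x₀ : ℕ, ∀ u : ℕ, 2 ≤ u → ∀ x : ℕ, x₀ ≤ x → RealRootedAt u x

/-- The uniform form implies the crux (it IS a strengthening). -/
theorem modelHyperbolicity_of_uniform : ModelHyperbolicityUniform → ModelHyperbolicity :=
  fun ⟨x₀, h⟩ u hu => ⟨x₀, h u hu⟩

/-- E1 (gen-1's only `sorry`, closed): no `x₀` serves every `u`. -/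
theorem not_modelHyperbolicityUniform : ¬ ModelHyperbolicityUniform := by
  rintro ⟨x₀, h⟩
  have hk : 5 ≤ max x₀ 5 := le_max_right _ _
  refine not_realRootedAt_succ_two_pow (max x₀ 5) hk (h _ (by omega) _ ?_)
  exact le_trans (le_max_left _ _) (Nat.lt_two_pow_self).le

/-- Quantitative form: the crux's threshold satisfies `x₀(u) > 2^{u-1}` for every `u ≥ 6`. -/
theorem not_realRootedAt_two_pow_pred (u : ℕ) (hu : 6 ≤ u) : ¬ RealRootedAt u (2 ^ (u - 1)) := by
  have := not_realRootedAt_succ_two_pow (u - 1) (by omega)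
  rwa [show u - 1 + 1 = u by omega] at this

end Summit.Parity.GeneralizedHardyLittlewood.Theorems.ModelHyperbolicity.Negative
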